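import Mathlib
import HarnessLib
import Summits.Ventures.LatticeQCDFlow.Exactness.HaarSU2Gaussian
import Summits.Ventures.LatticeQCDFlow.Exactness.SphereKickTHMC

/-!
# The Engel–Schaefer geodesic kick, read on `SU(2)` in quaternion coordinates, is a CERTIFIED link map for the Haar probability measure — the per-link Jacobian the `SU(2)` members were waiting for

HONEST FRAMING: exact (Metropolis-corrected) sampling algorithms for lattice gauge theory;
figures of merit are autocorrelation/cost numbers at stated couplings and volumes; no
continuum-physics claim.

Venture `LatticeQCDFlow` (cell pub-lqcd), topic `Exactness`; FANOUT row 14 (`eng-flowhmc`, engine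
`latflow.fthmc`, family B; member `maps.wilson_flow_lo` on the `SU(2)` rung).  NEW WORK of the
cell, a JOIN of two rows' machinery; nothing is cited as a fact; no number.

* Row 7 (`SphereKickJacobianTransport`, `SphereKickTHMC`): on the unit sphere of any real inner
  product space of dimension `n + 2` with the cone measure `μ.toSphere` of an additive Haar
  measure, the geodesic kick `sphereKick c J` towards a local field `J` (polar angle
  `θ' ↦ θ' − c‖J‖ sin θ'`, azimuth fixed) has the exact Jacobian `kickJac (c‖J‖) n (angle J ·)`
  and is a bijection for `|c| ‖J‖ ≤ 1`.
* Row 9 (`HaarSU2Gaussian`): quaternion coordinates `quatVec : ℝ⁴ → M₂(ℂ)` / `vecQuat`, the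
  unit part `gaussUnit : ℝ⁴ → SU(2)`, left multiplication `lmulIso A : ℝ⁴ ≃ₗᵢ ℝ⁴` and its
  equivariance `gaussUnit (lmulIso A x) = A * gaussUnit x`.

Joined here: the restriction of `gaussUnit` to `S³ ⊂ ℝ⁴` is a measurable bijection onto `SU(2)`
intertwining the isometries `lmulIso A` with left multiplication, so it carries the surface
measure `volume.toSphere` to a left-invariant finite measure, i.e. (uniqueness of Haar measure) to
`volume.toSphere(S³) • haarProbability SU(2)`; transporting row 7's Jacobian along it
(`HasJacobian.of_semiconj`, `HasJacobian.smul`) gives: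

  **`hasJacobian_su2Kick`** — for `J ∈ ℝ⁴`, `|c| ‖J‖ ≤ 1`, the map
  `U ↦ gaussUnit (geodesicKick c J (vecQuat U))` of `SU(2)` has
  `HasJacobian (haarProbability SU(2)) _ (kickJac (c‖J‖) 2 (angle J (vecQuat U)))`,
  and it is a measurable bijection of `SU(2)` (`bijective_su2Kick`).

Why this is the engine's `SU(2)` Wilson-flow Euler step (quaternion computation, recorded here, to
be typed in the member file): for `U ∈ SU(2)` and the staple sum `R` (a real multiple of an `SU(2)`
element), `P(UR) = Im(UR)` as quaternions and, writing `U R̂ = cos α + sin α n̂`,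
`exp(−ε‖R‖ sin α n̂) · (cos α + sin α n̂) = cos(α − ε‖R‖ sin α) + sin(α − ε‖R‖ sin α) n̂`: the
step `U ↦ exp(−ε P(UR)) U` moves `U` along the great circle through `U` and `R̂⁻¹ = R̂†`,
changing the polar angle from `R̂†` by `α ↦ α − ε‖R‖ sin α` — the geodesic kick with local field
`J = vecQuat R†` and `c = ε`, certified here as soon as `ε ‖R‖ ≤ 1` (the refusal rule
`2(d−1)ε ≤ 1`, since `‖R‖ ≤ 2(d−1)`).

NOT here: the masked sub-step / coupling layer on `GaugeConfig d L SU(2)` and FT-HMC (next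
files); the typed identification with the matrix-exponential form; `SU(N ≥ 3)`; any number.
-/

noncomputable section

namespace Summit.Ventures.LatticeQCDFlow.Exactness

open Real Set MeasureTheory Measure InnerProductGeometry Metric
open Literature.MathematicalPhysics.QuantumFieldTheory (haarProbability)
open scoped ENNReal

/-! ## `gaussUnit` restricted to the unit sphere is the quaternion-coordinate bijection `S³ → SU(2)` -/

section Coordinates

/-- A point of the unit sphere of `ℝ⁴` is not the origin. -/
theorem sphere_coe_ne_zero (x : sphere (0 : R4) 1) : (x : R4) ≠ 0 := by
  intro h
  have hx := norm_eq_of_mem_sphere x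
  rw [h, norm_zero] at hx
  exact zero_ne_one hx

/-- On the unit sphere, `gaussUnit` is `quatVec`. -/
theorem coe_gaussUnit_sphere (x : sphere (0 : R4) 1) :
    (gaussUnit (x : R4) : Matrix (Fin 2) (Fin 2) ℂ) = quatVec (x : R4) := by
  rw [coe_gaussUnit_of_ne_zero (sphere_coe_ne_zero x), norm_eq_of_mem_sphere x, inv_one, one_smul]

/-- `vecQuat` of an `SU(2)` element is a unit vector. -/
theorem norm_vecQuat_of_mem (U : Matrix.specialUnitaryGroup (Fin 2) ℂ) :
    ‖vecQuat (U : Matrix (Fin 2) (Fin 2) ℂ)‖ = 1 := by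
  have h := norm_vecQuat_sq (U : Matrix (Fin 2) (Fin 2) ℂ)
  rw [IsQuat.normSq_eq_one_of_mem U.2] at h
  have h0 : 0 ≤ ‖vecQuat (U : Matrix (Fin 2) (Fin 2) ℂ)‖ := norm_nonneg _
  nlinarith [h, h0]

/-- `vecQuat` of an `SU(2)` element is not the origin. -/
theorem vecQuat_ne_zero_of_mem (U : Matrix.specialUnitaryGroup (Fin 2) ℂ) :
    vecQuat (U : Matrix (Fin 2) (Fin 2) ℂ) ≠ 0 := by
  intro h
  have hn := norm_vecQuat_of_mem U
  rw [h, norm_zero] at hn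
  exact zero_ne_one hn

/-- `vecQuat ∘ gaussUnit = id` on the unit sphere. -/
theorem vecQuat_gaussUnit_sphere (x : sphere (0 : R4) 1) :
    vecQuat (gaussUnit (x : R4) : Matrix (Fin 2) (Fin 2) ℂ) = (x : R4) := by
  rw [coe_gaussUnit_sphere, vecQuat_quatVec]

/-- `gaussUnit ∘ vecQuat = id` on `SU(2)`. -/
theorem gaussUnit_vecQuat (U : Matrix.specialUnitaryGroup (Fin 2) ℂ) :
    gaussUnit (vecQuat (U : Matrix (Fin 2) (Fin 2) ℂ)) = U := by
  apply Subtype.ext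
  rw [coe_gaussUnit_of_ne_zero (vecQuat_ne_zero_of_mem U), norm_vecQuat_of_mem U, inv_one,
    one_smul, quatVec_vecQuat (IsQuat.of_mem_specialUnitaryGroup U.2)]

/-- `gaussUnit` restricted to the unit sphere is a bijection onto `SU(2)`. -/
theorem bijective_gaussUnit_sphere :
    Function.Bijective fun x : sphere (0 : R4) 1 => gaussUnit (x : R4) := by
  refine ⟨fun x y h => ?_, fun U => ?_⟩
  · have h' := congrArg (fun U : Matrix.specialUnitaryGroup (Fin 2) ℂ =>
      vecQuat (U : Matrix (Fin 2) (Fin 2) ℂ)) h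
    simp only [vecQuat_gaussUnit_sphere] at h'
    exact Subtype.ext h'
  · refine ⟨⟨vecQuat (U : Matrix (Fin 2) (Fin 2) ℂ), ?_⟩, gaussUnit_vecQuat U⟩
    rw [mem_sphere_zero_iff_norm]
    exact norm_vecQuat_of_mem U

/-- `gaussUnit` restricted to the unit sphere is measurable. -/
theorem measurable_gaussUnit_sphere :
    Measurable fun x : sphere (0 : R4) 1 => gaussUnit (x : R4) :=
  measurable_gaussUnit.comp measurable_subtype_coe

/-- Equivariance on the sphere: `gaussUnit (A · x) = A * gaussUnit x`. -/
theorem gaussUnit_isoSphere_lmulIso (A : Matrix.specialUnitaryGroup (Fin 2) ℂ)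
    (x : sphere (0 : R4) 1) :
    gaussUnit ((isoSphere (lmulIso A) x : sphere (0 : R4) 1) : R4) = A * gaussUnit (x : R4) :=
  gaussUnit_lmul A (sphere_coe_ne_zero x)

end Coordinates

/-! ## The surface measure of `S³` is carried to a multiple of Haar measure on `SU(2)` -/

section Haar

/-- **`gaussUnit_* (volume.toSphere) = volume.toSphere(S³) • haarProbability SU(2)`**: the
push-forward of the surface measure is left invariant (each `A ∈ SU(2)` acts on `ℝ⁴` by the
linear isometry `lmulIso A`, which preserves `volume`, hence its cone measure), so it is the Haar
probability measure up to its total mass (uniqueness of Haar measure on the compact group). -/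
theorem map_gaussUnit_toSphere :
    ((volume : Measure R4).toSphere).map (fun x : sphere (0 : R4) 1 => gaussUnit (x : R4)) =
      ((volume : Measure R4).toSphere univ) •
        haarProbability (Matrix.specialUnitaryGroup (Fin 2) ℂ) := by
  set ν := ((volume : Measure R4).toSphere).map (fun x : sphere (0 : R4) 1 => gaussUnit (x : R4))
    with hν
  haveI : IsFiniteMeasure ν := Measure.isFiniteMeasure_map _ _
  haveI : ν.IsMulLeftInvariant := by
    refine ⟨fun A => ?_⟩
    rw [hν, Measure.map_map (measurable_const_mul A) measurable_gaussUnit_sphere]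
    have hfun : ((fun U : Matrix.specialUnitaryGroup (Fin 2) ℂ => A * U) ∘ fun x : sphere (0 : R4) 1 =>
        gaussUnit (x : R4)) = (fun x : sphere (0 : R4) 1 => gaussUnit (x : R4)) ∘ (isoSphere (lmulIso A)) := by
      funext x
      simp only [Function.comp_apply]
      exact (gaussUnit_isoSphere_lmulIso A x).symm
    rw [hfun, ← Measure.map_map measurable_gaussUnit_sphere (isoSphere (lmulIso A)).measurable,
      map_isoSphere_toSphere, (lmulIso A).measurePreserving.map_eq]
  have h := Measure.haarMeasure_unique ν ⊤
  rw [h, TopologicalSpace.PositiveCompacts.coe_top, hν,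
    Measure.map_apply measurable_gaussUnit_sphere MeasurableSet.univ, Set.preimage_univ]
  rfl

/-- The total surface measure of `S³` is positive … -/
theorem toSphere_R4_univ_ne_zero : (volume : Measure R4).toSphere univ ≠ 0 := by
  rw [Measure.toSphere_apply_univ]
  refine mul_ne_zero ?_ (measure_ball_pos volume (0 : R4) one_pos).ne'
  have : Module.finrank ℝ R4 = 4 := finrank_euclideanSpace_fin
  rw [this]
  norm_num

/-- … and finite. -/
theorem toSphere_R4_univ_ne_top : (volume : Measure R4).toSphere univ ≠ ∞ :=
  measure_ne_top _ _

end Haar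

/-! ## The kick read on `SU(2)` -/

section Kick

variable {c : ℝ} {J : R4}

/-- `vecQuat` (real coordinates of a quaternion matrix) is continuous. -/
theorem continuous_vecQuat : Continuous vecQuat := by
  have h00 : Continuous fun M : Matrix (Fin 2) (Fin 2) ℂ => M 0 0 :=
    (continuous_apply 0).comp (continuous_apply 0)
  have h01 : Continuous fun M : Matrix (Fin 2) (Fin 2) ℂ => M 0 1 :=
    (continuous_apply 1).comp (continuous_apply 0)
  unfold vecQuat
  refine (PiLp.continuous_toLp 2 _).comp (continuous_pi fun i => ?_)
  fin_cases i
  · show Continuous fun M : Matrix (Fin 2) (Fin 2) ℂ => (M 0 0).re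
    exact Complex.continuous_re.comp h00
  · show Continuous fun M : Matrix (Fin 2) (Fin 2) ℂ => (M 0 1).im
    exact Complex.continuous_im.comp h01
  · show Continuous fun M : Matrix (Fin 2) (Fin 2) ℂ => (M 0 1).re
    exact Complex.continuous_re.comp h01
  · show Continuous fun M : Matrix (Fin 2) (Fin 2) ℂ => (M 0 0).im
    exact Complex.continuous_im.comp h00

/-- The polar angle from a fixed vector is a measurable function on `ℝ⁴`. -/
theorem measurable_angle_right (J : R4) : Measurable fun y : R4 => angle J y := by
  unfold angle
  exact Real.continuous_arccos.measurable.comp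
    ((continuous_const.inner continuous_id).measurable.div
      (measurable_const.mul continuous_norm.measurable))

/-- `ℝ⁴` has dimension `2 + 2` (the sphere kick on `S³` is the case `n = 2` of row 7's files). -/
theorem finrank_R4 : Module.finrank ℝ R4 = 2 + 2 := by
  rw [finrank_euclideanSpace_fin]

/-- The `SU(2)` kick intertwines with the sphere kick through `gaussUnit`. -/
theorem su2Kick_gaussUnit (c : ℝ) (J : R4) (x : sphere (0 : R4) 1) :
    gaussUnit (geodesicKick c J (vecQuat (gaussUnit (x : R4) : Matrix (Fin 2) (Fin 2) ℂ))) =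
      gaussUnit ((sphereKick c J x : sphere (0 : R4) 1) : R4) := by
  rw [vecQuat_gaussUnit_sphere, coe_sphereKick]

/-- **The kick read on `SU(2)` is a certified link map for the Haar probability measure.**  For
`J ∈ ℝ⁴` and `|c| ‖J‖ ≤ 1`, `U ↦ gaussUnit (geodesicKick c J (vecQuat U))` has
`HasJacobian (haarProbability SU(2)) _ (kickJac (c‖J‖) 2 (angle J (vecQuat U)))` — row 7's
Engel–Schaefer Jacobian (`(1 − κ cos θ')(sin θ / sin θ')²`, `κ = c‖J‖`, `θ'` the polar angle from
`J`) transported to the group. -/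
theorem hasJacobian_su2Kick (hc : |c| * ‖J‖ ≤ 1) :
    HasJacobian (haarProbability (Matrix.specialUnitaryGroup (Fin 2) ℂ))
      (fun U : Matrix.specialUnitaryGroup (Fin 2) ℂ =>
        gaussUnit (geodesicKick c J (vecQuat (U : Matrix (Fin 2) (Fin 2) ℂ))))
      fun U => ENNReal.ofReal (kickJac (c * ‖J‖) 2 (angle J (vecQuat (U : Matrix (Fin 2) (Fin 2) ℂ)))) := by
  have hsph := hasJacobian_sphereKick' 2 finrank_R4 (volume : Measure R4) hc
  -- transport along `gaussUnit : S³ → SU(2)`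
  have hF : Measurable fun U : Matrix.specialUnitaryGroup (Fin 2) ℂ =>
      gaussUnit (geodesicKick c J (vecQuat (U : Matrix (Fin 2) (Fin 2) ℂ))) :=
    measurable_gaussUnit.comp ((continuous_geodesicKick c J).comp
      (continuous_vecQuat.comp continuous_subtype_val)).measurable
  have hj : Measurable fun U : Matrix.specialUnitaryGroup (Fin 2) ℂ =>
      ENNReal.ofReal (kickJac (c * ‖J‖) 2 (angle J (vecQuat (U : Matrix (Fin 2) (Fin 2) ℂ)))) :=
    ((measurable_kickJac (c * ‖J‖) 2).comp ((measurable_angle_right J).comp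
      (continuous_vecQuat.comp continuous_subtype_val).measurable)).ennreal_ofReal
  have h := HasJacobian.of_semiconj (ρ := (volume : Measure R4).toSphere)
    measurable_gaussUnit_sphere hsph hF hj
    (Filter.Eventually.of_forall fun x => (su2Kick_gaussUnit c J x))
    (Filter.Eventually.of_forall fun x => by simp only [vecQuat_gaussUnit_sphere])
  rw [map_gaussUnit_toSphere] at h
  have h' := h.smul ((volume : Measure R4).toSphere univ)⁻¹
  rwa [smul_smul, ENNReal.inv_mul_cancel toSphere_R4_univ_ne_zero toSphere_R4_univ_ne_top,
    one_smul] at h'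

/-- The kick read on `SU(2)` is a bijection of `SU(2)` for `|c| ‖J‖ ≤ 1`. -/
theorem bijective_su2Kick (hc : |c| * ‖J‖ ≤ 1) :
    Function.Bijective fun U : Matrix.specialUnitaryGroup (Fin 2) ℂ =>
      gaussUnit (geodesicKick c J (vecQuat (U : Matrix (Fin 2) (Fin 2) ℂ))) := by
  have hΘ := bijective_gaussUnit_sphere
  have hK := bijective_sphereKick 2 finrank_R4 hc
  constructor
  · intro U U' h
    obtain ⟨x, rfl⟩ := hΘ.2 U
    obtain ⟨x', rfl⟩ := hΘ.2 U'
    simp only [su2Kick_gaussUnit] at h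
    simp only [hK.1 (hΘ.1 h)]
  · intro W
    obtain ⟨y, rfl⟩ := hΘ.2 W
    obtain ⟨x, rfl⟩ := hK.2 y
    exact ⟨gaussUnit (x : R4), su2Kick_gaussUnit c J x⟩

end Kick

end Summit.Ventures.LatticeQCDFlow.Exactness
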